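import Literature.AlgebraicGeometry.Frobenioids.ModelFrobenioidRationalFunctionsProofs
import Literature.AlgebraicGeometry.Frobenioids.ModelFrobenioidPullbacks
import Literature.AlgebraicGeometry.Frobenioids.ModelFrobenioidFunctor
import Literature.AlgebraicGeometry.Frobenioids.BiratUnitsEquivalence
import Literature.AlgebraicGeometry.Frobenioids.BiratUnitsIntertwines
import Literature.AlgebraicGeometry.Frobenioids.BiratLocalization
import Literature.AlgebraicGeometry.Frobenioids.DivisorMonoidCategoryTheoreticity
import HarnessLib

/-!
# Frobenioids I, Cor. 4.10 / 4.11 (iii) with Thm. 5.2 (ii): an equivalence of MODEL Frobenioids transports the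
# rational function monoid — the comparison data `(Φ₁ ⥲ Φ₂, B₁ ⥲ B₂)` over `Ψ^Base`, natural and `Div_B`-compatible

Mochizuki, *The geometry of Frobenioids I: the general theory*, Kyushu J. Math. **62** (2008) 293–400:
Cor. 4.10 p. 90 ("`Ψ` induces a 1-unique functor `Ψ^birat : C₁^birat → C₂^birat`"), Cor. 4.11 (iii) p. 92
("there exists an isomorphism of functors `Ψ^Φ : Φ₁ ⥲ Φ₂` lying over the equivalence `Ψ^Base`"), Thm. 5.2 (ii)
p. 101 ("there is a natural isomorphism of functors between the functor `O^×(−)` on `D` associated to the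
Frobenioid `C^birat` … and the functor `B`; this isomorphism is compatible with … `Div_B : B → Φ^gp`")
[cite: MochizukiFrdI2008, Thm. 5.2 (ii) p.101]; used verbatim in *The geometry of Frobenioids II*, proof of
Thm. 2.4 (i), p. 20 ll. 27–40: "it follows from [Mzk5], Corollaries 4.10; 4.11, (ii), (iii), that `Ψ` induces a
1-compatible equivalence of categories `Ψ^Base : D₁ ⥲ D₂`, as well as compatible isomorphisms of functors
`Φ₁ ⥲ Φ₂`, `B₁ ⥲ B₂`" [cite: MochizukiFrdII2008, Thm 2.4 (i) p.20].

PROOF-ONLY file (cell abc-iut, layer L1, seat abc-iut-L1-t10 gen 9; row «HFS-FROM-Ψ» of NODES FrdII:Thm2.4(i),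
L1-lead GO 2026-08-26T13:10Z / GO-2 13:23Z).  Everything BY NAME from landed files; no definitions, no new `Prop`:
* §1 (any Frobenioids) `PreFrobenioid.BiratUnits.Intertwines.map_equivalence` — the intertwining relation
  "`ψ ∘ u = v ∘ ψ` in `C^birat`" (Prop. 2.2 (ii)) is carried by `Ψ` to `Ψ ψ`, `Ψ^birat u`, `Ψ^birat v`
  (`BiratUnits.mapEquiv` of `BiratUnitsEquivalence.lean`); `BiratUnits.divHom_mapEquiv` — the divisor map
  `O^×(A^birat) → Φ^gp(A)` (Prop. 4.4 (iii)) is transported through any `Ψ^Φ` over `Ψ` carrying `Div φ` to `Div(Ψ φ)`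
  (abc-iut-L1-d6's `DivisorMonoidIsoOver`, [FrdI] Thm. 4.9 / Cor. 4.11 (iii));
* §2 (model Frobenioids `C_i = C(Φ_i, B_i, Div_{B_i})`, `B_i` group-like, `Φ_i` divisorial) — for an equivalence
  `Ψ : C₁ ⥲ C₂` such that `Ψ^{±1}` preserve co-angular pre-steps and base-equivalent pairs and `Ψ` preserves
  pull-back morphisms ([FrdI] Thm. 3.4 (ii)(iii)), an equivalence `E : D₁ ⥲ D₂` with
  `η : Ψ ⋙ Base₂ ≅ Base₁ ⋙ E` (Thm. 3.4 (v)) and a `Ψ^Φ` over `Ψ` with the divisor clause (Thm. 4.9):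
  **`ModelFrobenioid.exists_comparisonData_of_equivalence`** — isomorphisms `φ_X : Φ₁(X) ⥲ Φ₂(E X)` and
  `β_X : B₁(X) ⥲ B₂(E X)`, natural in `X ∈ Ob(D₁)` and with `Div_{B₂} ∘ β = φ^gp ∘ Div_{B₁}` — through abc-iut-L1-t2's
  Thm. 5.2 (ii) isomorphism `ModelFrobenioid.ratIso : B(A_D) ⥲ O^×(A^birat)` at the objects `(X, 0)` on both
  sides and abc-iut-L1's `BiratUnits.equivOfEquiv` (Cor. 4.10 on `O^×(A^birat)`); naturality from `ratIso_natural`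
  (Prop. 2.2 (ii) along the linear lifts `(1, f, 0, 1)` of the arrows of `D₁`) and uniqueness of the intertwiner
  along the pull-back morphism `Ψ(1, f, 0, 1)` (`BiratUnits.eq_of_intertwines_of_isPullbackMorphism`).
These are exactly the binders `(E, φ, hφ, β, hβ, hβdiv)` of abc-iut-w5-d229's
`PadicFrd.Datum.isFieldwiseSaturated_iff_of_equiv_temperedBase` ([FrdII] Thm. 2.4 (i), «`Φ₁` is fieldwise saturated
iff `Φ₂` is»).  No statement of either paper is restated or strengthened; nothing here bears on [IUTchIII].
-/

noncomputable section

namespace Literature.AlgebraicGeometry.Frobenioids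

open CategoryTheory Opposite

universe w v v' u u'

/-! ### §1 Transport of the intertwining relation and of the divisor map along an equivalence -/

namespace PreFrobenioid

namespace BiratUnits

variable {D₁ : Type u} [Category.{v} D₁] {Φ₁ : D₁ᵒᵖ ⥤ CommMonCat.{w}} {C₁ : Type u'} [Category.{v'} C₁]
  {F₁ : C₁ ⥤ ElemFrobenioid Φ₁}
  {D₂ : Type u} [Category.{v} D₂] {Φ₂ : D₂ᵒᵖ ⥤ CommMonCat.{w}} {C₂ : Type u'} [Category.{v'} C₂]
  {F₂ : C₂ ⥤ ElemFrobenioid Φ₂}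
  (hF₁ : IsFrobenioid F₁) (hF₂ : IsFrobenioid F₂) (Ψ : C₁ ≌ C₂)
  (hΨ : ∀ ⦃A B : C₁⦄ (f : A ⟶ B), IsCoAngularPreStep F₁ f → IsCoAngularPreStep F₂ (Ψ.functor.map f))
  (hb : ∀ ⦃A B : C₁⦄ (f g : A ⟶ B), BaseEquivalent F₁ f g →
    BaseEquivalent F₂ (Ψ.functor.map f) (Ψ.functor.map g))

/-- **`Ψ^birat` respects "`ψ ∘ u = v ∘ ψ`"** (Prop. 2.2 (ii) in `C^birat`; Cor. 4.10): if `u ∈ O^×(A^birat)` and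
`v ∈ O^×(A'^birat)` are intertwined along `ψ : A → A'`, then `Ψ^birat u`, `Ψ^birat v` are intertwined along `Ψ ψ` —
apply `Ψ` to the witnessing fractions and square. [cite: MochizukiFrdI2008, Cor. 4.10 p.90] -/
theorem Intertwines.map_equivalence {A A' : C₁} {ψ : A ⟶ A'} {u : BiratUnits F₁ hF₁ A} {v : BiratUnits F₁ hF₁ A'}
    (h : Intertwines hF₁ ψ u v) :
    Intertwines hF₂ (Ψ.functor.map ψ) (mapEquiv Ψ hΨ hb hF₁ hF₂ A u) (mapEquiv Ψ hΨ hb hF₁ hF₂ A' v) := by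
  obtain ⟨p, q, E, κ, l, hp, hq, hκ, h₁, h₂⟩ := h
  refine ⟨p.mapEquiv Ψ hΨ hb, q.mapEquiv Ψ hΨ hb, Ψ.functor.obj E, Ψ.functor.map κ, Ψ.functor.map l, ?_, ?_,
    hΨ _ hκ, ?_, ?_⟩
  · rw [← hp, mapEquiv_mk]
  · rw [← hq, mapEquiv_mk]
  · change Ψ.functor.map l ≫ Ψ.functor.map q.den = Ψ.functor.map κ ≫ Ψ.functor.map p.den ≫ Ψ.functor.map ψ
    rw [← Functor.map_comp, h₁, Functor.map_comp, Functor.map_comp]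
  · change Ψ.functor.map l ≫ Ψ.functor.map q.num = Ψ.functor.map κ ≫ Ψ.functor.map p.num ≫ Ψ.functor.map ψ
    rw [← Functor.map_comp, h₂, Functor.map_comp, Functor.map_comp]

variable (ΨΦ : (PreFrobenioidData.ofFunctor Φ₁ F₁).DivisorMonoidIsoOver (PreFrobenioidData.ofFunctor Φ₂ F₂) Ψ)
  (hdiv : ∀ ⦃A B : C₁⦄ (φ : A ⟶ B), ΨΦ.iso A (Div F₁ φ) = Div F₂ (Ψ.functor.map φ))

include hdiv in
/-- A `Ψ^Φ` over `Ψ` carrying `Div φ` to `Div(Ψ φ)` carries `(ψ^*)⁻¹ Div ψ` to `((Ψ ψ)^*)⁻¹ Div(Ψ ψ)` for a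
base-isomorphism `ψ` (naturality of `Ψ^Φ` along `ψ`, then cancel the bijection `(Ψ ψ)^*`).
[cite: MochizukiFrdI2008, Cor. 4.11 (iii) p.92] -/
theorem divisorMonoidIsoOver_invDiv {X A : C₁} (ψ : X ⟶ A) (h₁ : IsBaseIso F₁ ψ) (h₂ : IsBaseIso F₂ (Ψ.functor.map ψ)) :
    ΨΦ.iso A (invDiv F₁ ψ h₁) = invDiv F₂ (Ψ.functor.map ψ) h₂ := by
  haveI : IsIso (Base F₂ (Ψ.functor.map ψ)) := h₂
  have hinj : Function.Injective (pull Φ₂ (Base F₂ (Ψ.functor.map ψ))) := by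
    intro x y hxy
    have := congrArg (pull Φ₂ (inv (Base F₂ (Ψ.functor.map ψ)))) hxy
    rwa [← pull_comp, ← pull_comp, IsIso.inv_hom_id, pull_id, pull_id] at this
  apply hinj
  have hnat := ΨΦ.natural ψ (invDiv F₁ ψ h₁)
  change ΨΦ.iso X (pull Φ₁ (Base F₁ ψ) (invDiv F₁ ψ h₁)) =
    pull Φ₂ (Base F₂ (Ψ.functor.map ψ)) (ΨΦ.iso A (invDiv F₁ ψ h₁)) at hnat
  rw [← hnat, pull_invDiv, pull_invDiv, hdiv]

include hdiv in
/-- **The divisor map `O^×(A^birat) → Φ^gp(A)` is transported by `Ψ^birat` through `Ψ^Φ`**: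
`Div(Ψ^birat u) = (Ψ^Φ_A)^gp (Div u)` (Prop. 4.4 (iii) with Cor. 4.11 (iii)). [cite: MochizukiFrdI2008, Cor. 4.11 (iii) p.92] -/
theorem divHom_mapEquiv (A : C₁) (u : BiratUnits F₁ hF₁ A) :
    divHom hF₂ (Ψ.functor.obj A) (mapEquiv Ψ hΨ hb hF₁ hF₂ A u) =
      MonGp.map (ΨΦ.iso A).toMonoidHom (divHom hF₁ A u) := by
  obtain ⟨p, rfl⟩ := mk_surjective (F := F₁) (hF := hF₁) (A := A) u
  rw [mapEquiv_mk, divHom_mk, divHom_mk]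
  change Algebra.GrothendieckGroup.of (invDiv F₂ (Ψ.functor.map p.num) _) /
      Algebra.GrothendieckGroup.of (invDiv F₂ (Ψ.functor.map p.den) _) =
    MonGp.map (ΨΦ.iso A).toMonoidHom
      (Algebra.GrothendieckGroup.of (invDiv F₁ p.num p.num_mem.2.2) /
        Algebra.GrothendieckGroup.of (invDiv F₁ p.den p.den_mem.2.2))
  erw [map_div, MonGp.map_of, MonGp.map_of]
  exact congrArg₂ (fun x y => Algebra.GrothendieckGroup.of x / Algebra.GrothendieckGroup.of y)
    (divisorMonoidIsoOver_invDiv Ψ ΨΦ hdiv p.num p.num_mem.2.2 (hΨ _ p.num_mem).2.2).symm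
    (divisorMonoidIsoOver_invDiv Ψ ΨΦ hdiv p.den p.den_mem.2.2 (hΨ _ p.den_mem).2.2).symm

end BiratUnits

end PreFrobenioid

/-! ### §2 Model Frobenioids: the comparison data `(Φ₁ ⥲ Φ₂, B₁ ⥲ B₂)` induced by an equivalence -/

namespace ModelFrobenioid

variable {D₁ : Type u} [Category.{v} D₁] {Φ₁ B₁ : D₁ᵒᵖ ⥤ CommMonCat.{w}} {DivB₁ : B₁ ⟶ monoidGp Φ₁}
  {D₂ : Type u} [Category.{v} D₂] {Φ₂ B₂ : D₂ᵒᵖ ⥤ CommMonCat.{w}} {DivB₂ : B₂ ⟶ monoidGp Φ₂}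
  (hBg₁ : Objectwise (fun M _ => IsGroupLike M) B₁) (hΦd₁ : Objectwise (fun M _ => IsDivisorial M) Φ₁)
  (hBg₂ : Objectwise (fun M _ => IsGroupLike M) B₂) (hΦd₂ : Objectwise (fun M _ => IsDivisorial M) Φ₂)
  (hF₁ : PreFrobenioid.IsFrobenioid (toElem Φ₁ B₁ DivB₁)) (hF₂ : PreFrobenioid.IsFrobenioid (toElem Φ₂ B₂ DivB₂))
  (Ψ : ModelFrobenioid Φ₁ B₁ DivB₁ ≌ ModelFrobenioid Φ₂ B₂ DivB₂)
  (hΨ : ∀ ⦃A A' : ModelFrobenioid Φ₁ B₁ DivB₁⦄ (f : A ⟶ A'), PreFrobenioid.IsCoAngularPreStep (toElem Φ₁ B₁ DivB₁) f →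
    PreFrobenioid.IsCoAngularPreStep (toElem Φ₂ B₂ DivB₂) (Ψ.functor.map f))
  (hb : ∀ ⦃A A' : ModelFrobenioid Φ₁ B₁ DivB₁⦄ (f g : A ⟶ A'), PreFrobenioid.BaseEquivalent (toElem Φ₁ B₁ DivB₁) f g →
    PreFrobenioid.BaseEquivalent (toElem Φ₂ B₂ DivB₂) (Ψ.functor.map f) (Ψ.functor.map g))
  (hΨ' : ∀ ⦃A A' : ModelFrobenioid Φ₂ B₂ DivB₂⦄ (f : A ⟶ A'), PreFrobenioid.IsCoAngularPreStep (toElem Φ₂ B₂ DivB₂) f →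
    PreFrobenioid.IsCoAngularPreStep (toElem Φ₁ B₁ DivB₁) (Ψ.inverse.map f))
  (hb' : ∀ ⦃A A' : ModelFrobenioid Φ₂ B₂ DivB₂⦄ (f g : A ⟶ A'), PreFrobenioid.BaseEquivalent (toElem Φ₂ B₂ DivB₂) f g →
    PreFrobenioid.BaseEquivalent (toElem Φ₁ B₁ DivB₁) (Ψ.inverse.map f) (Ψ.inverse.map g))
  (hpb : ∀ ⦃A A' : ModelFrobenioid Φ₁ B₁ DivB₁⦄ (ψ : A ⟶ A'), PreFrobenioid.IsPullbackMorphism (toElem Φ₁ B₁ DivB₁) ψ →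
    PreFrobenioid.IsPullbackMorphism (toElem Φ₂ B₂ DivB₂) (Ψ.functor.map ψ))

/-- The zero-section lift `(1, f, 0, 1) : (Y, 0) → (X, 0)` of `f : Y → X` is a pull-back morphism of the model
Frobenioid (`isPullbackMorphism_of`: linear with `Div = 0`). [cite: MochizukiFrdI2008, Thm. 5.2(ii) p.101] -/
theorem isPullbackMorphism_zeroHom (hBg₁ : Objectwise (fun M _ => IsGroupLike M) B₁)
    (hΦd₁ : Objectwise (fun M _ => IsDivisorial M) Φ₁) {X Y : D₁} (f : Y ⟶ X) :
    PreFrobenioid.IsPullbackMorphism (toElem Φ₁ B₁ DivB₁) (zeroHom (Φ := Φ₁) (B := B₁) (DivB := DivB₁) 1 f) :=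
  isPullbackMorphism_of hΦd₁ hBg₁ rfl rfl

include hΦd₂ hpb in
/-- **Naturality of `B₁(X) ⥲ O^×((X,0)^birat) ⥲ O^×(Ψ(X,0)^birat) ⥲ B₂(Ψ(X,0)_D)`** along `f : Y → X`: the
`B₁`-pull-back along `f` goes to the `B₂`-pull-back along `Base(Ψ(1, f, 0, 1))` — Prop. 2.2 (ii) on both sides
(`ratIso_natural`), `Ψ^birat` on the intertwining square, and uniqueness of the intertwiner along the pull-back
morphism `Ψ(1, f, 0, 1)`. [cite: MochizukiFrdI2008, Thm. 5.2 (ii) p.101] -/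
theorem ratTransport_natural {X Y : D₁} (f : Y ⟶ X) (b : B₁.obj (op X)) :
    (ratIso hBg₂ hΦd₂ hF₂ (Ψ.functor.obj (zeroObj Φ₁ B₁ DivB₁ Y))).symm
        (PreFrobenioid.BiratUnits.equivOfEquiv Ψ hΨ hb hF₁ hF₂ hΨ' hb' (zeroObj Φ₁ B₁ DivB₁ Y)
          (ratIso hBg₁ hΦd₁ hF₁ (zeroObj Φ₁ B₁ DivB₁ Y) ((B₁.map f.op).hom b))) =
      (B₂.map (baseMap (Ψ.functor.map (zeroHom (Φ := Φ₁) (B := B₁) (DivB := DivB₁) 1 f))).op).hom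
        ((ratIso hBg₂ hΦd₂ hF₂ (Ψ.functor.obj (zeroObj Φ₁ B₁ DivB₁ X))).symm
          (PreFrobenioid.BiratUnits.equivOfEquiv Ψ hΨ hb hF₁ hF₂ hΨ' hb' (zeroObj Φ₁ B₁ DivB₁ X)
            (ratIso hBg₁ hΦd₁ hF₁ (zeroObj Φ₁ B₁ DivB₁ X) b))) := by
  -- notation-free abbreviations
  have hlin₁ : PreFrobenioid.IsLinear (toElem Φ₁ B₁ DivB₁) (zeroHom (Φ := Φ₁) (B := B₁) (DivB := DivB₁) 1 f) := rfl
  have hpb₂ := hpb _ (isPullbackMorphism_zeroHom hBg₁ hΦd₁ f)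
  have hlin₂ : PreFrobenioid.IsLinear (toElem Φ₂ B₂ DivB₂)
      (Ψ.functor.map (zeroHom (Φ := Φ₁) (B := B₁) (DivB := DivB₁) 1 f)) :=
    (degFr_div_of_isPullbackMorphism hΦd₂ hpb₂).1
  -- side 1: Prop. 2.2 (ii) for `ratIso`, pushed through `Ψ^birat`
  have h₁ := PreFrobenioid.BiratUnits.Intertwines.map_equivalence hF₁ hF₂ Ψ hΨ hb
    (ratIso_natural hBg₁ hΦd₁ hF₁ (zeroHom (Φ := Φ₁) (B := B₁) (DivB := DivB₁) 1 f) hlin₁ b)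
  -- side 2: Prop. 2.2 (ii) for `ratIso` at the transported element
  have h₂ := ratIso_natural hBg₂ hΦd₂ hF₂ (Ψ.functor.map (zeroHom (Φ := Φ₁) (B := B₁) (DivB := DivB₁) 1 f)) hlin₂
    ((ratIso hBg₂ hΦd₂ hF₂ (Ψ.functor.obj (zeroObj Φ₁ B₁ DivB₁ X))).symm
      (PreFrobenioid.BiratUnits.equivOfEquiv Ψ hΨ hb hF₁ hF₂ hΨ' hb' (zeroObj Φ₁ B₁ DivB₁ X)
        (ratIso hBg₁ hΦd₁ hF₁ (zeroObj Φ₁ B₁ DivB₁ X) b)))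
  rw [MulEquiv.apply_symm_apply, PreFrobenioid.BiratUnits.equivOfEquiv_apply] at h₂
  -- uniqueness of the intertwiner along the pull-back morphism `Ψ(1, f, 0, 1)`
  have h₃ := PreFrobenioid.BiratUnits.eq_of_intertwines_of_isPullbackMorphism
    (PreFrobenioid.hasBiratSquares_of_isFrobenioid hF₂) hpb₂ h₁ h₂
  rw [MulEquiv.symm_apply_eq, PreFrobenioid.BiratUnits.equivOfEquiv_apply]
  exact h₃

variable (ΨΦ : (PreFrobenioidData.ofFunctor Φ₁ (toElem Φ₁ B₁ DivB₁)).DivisorMonoidIsoOver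
    (PreFrobenioidData.ofFunctor Φ₂ (toElem Φ₂ B₂ DivB₂)) Ψ)
  (hdiv : ∀ ⦃A A' : ModelFrobenioid Φ₁ B₁ DivB₁⦄ (φ : A ⟶ A'),
    ΨΦ.iso A (PreFrobenioid.Div (toElem Φ₁ B₁ DivB₁) φ) = PreFrobenioid.Div (toElem Φ₂ B₂ DivB₂) (Ψ.functor.map φ))

include hdiv in
/-- **`Div_B`-compatibility of the transport**: `Div_{B₂}` of the transported element is `(Ψ^Φ_{(X,0)})^gp` of
`Div_{B₁}` — Thm. 5.2 (ii) "compatible with `Div_B`" (`divHom_ratIso`) on both sides and `divHom_mapEquiv`.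
[cite: MochizukiFrdI2008, Thm. 5.2 (ii) p.101] -/
theorem ratTransport_divB (X : D₁) (b : B₁.obj (op X)) :
    divB Φ₂ B₂ DivB₂ (op (Ψ.functor.obj (zeroObj Φ₁ B₁ DivB₁ X)).base)
        ((ratIso hBg₂ hΦd₂ hF₂ (Ψ.functor.obj (zeroObj Φ₁ B₁ DivB₁ X))).symm
          (PreFrobenioid.BiratUnits.equivOfEquiv Ψ hΨ hb hF₁ hF₂ hΨ' hb' (zeroObj Φ₁ B₁ DivB₁ X)
            (ratIso hBg₁ hΦd₁ hF₁ (zeroObj Φ₁ B₁ DivB₁ X) b))) =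
      MonGp.map (ΨΦ.iso (zeroObj Φ₁ B₁ DivB₁ X)).toMonoidHom (divB Φ₁ B₁ DivB₁ (op X) b) := by
  rw [← divHom_ratIso hBg₂ hΦd₂ hF₂, MulEquiv.apply_symm_apply, PreFrobenioid.BiratUnits.equivOfEquiv_apply,
    PreFrobenioid.BiratUnits.divHom_mapEquiv hF₁ hF₂ Ψ hΨ hb ΨΦ hdiv, divHom_ratIso hBg₁ hΦd₁ hF₁]

include hBg₁ hΦd₁ hBg₂ hΦd₂ hF₁ hF₂ hΨ hb hΨ' hb' hpb hdiv in
/-- **[FrdI] Cor. 4.10 / 4.11 (iii) + Thm. 5.2 (ii) for an equivalence of MODEL Frobenioids: the comparison data.**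
For `C_i = C(Φ_i, B_i, Div_{B_i})` (`B_i` group-like, `Φ_i` divisorial, `C_i → F_{Φ_i}` Frobenioids) and an equivalence
`Ψ : C₁ ⥲ C₂` such that `Ψ^{±1}` preserve co-angular pre-steps and base-equivalent pairs and `Ψ` preserves pull-back
morphisms (Thm. 3.4 (ii)(iii)(v)), every `Ψ^Φ` over `Ψ` carrying `Div φ ↦ Div(Ψ φ)` (Thm. 4.9 / Cor. 4.11 (iii)) comes
with isomorphisms `φ_X : Φ₁(X) ⥲ Φ₂(G X)`, `β_X : B₁(X) ⥲ B₂(G X)` over the functor `G := X ↦ Ψ(X, 0)_D`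
(`zeroSection ⋙ Ψ ⋙ Base`, which Thm. 3.4 (v)'s `η` identifies with `Ψ^Base`), natural in `X` and satisfying
`Div_{B₂} ∘ β_X = φ_X^gp ∘ Div_{B₁}` — "compatible isomorphisms of functors `Φ₁ ⥲ Φ₂`, `B₁ ⥲ B₂`" preserving `O^⊳(−)`
([FrdII] p. 20). [cite: MochizukiFrdI2008, Thm. 5.2 (ii) p.101] -/
theorem exists_comparisonData_of_equivalence :
    ∃ (φ : ∀ X : D₁, Φ₁.obj (op X) ≃*
        Φ₂.obj (op ((zeroSection Φ₁ B₁ DivB₁ ⋙ Ψ.functor ⋙ baseFunctor Φ₂ B₂ DivB₂).obj X)))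
      (β : ∀ X : D₁, B₁.obj (op X) ≃*
        B₂.obj (op ((zeroSection Φ₁ B₁ DivB₁ ⋙ Ψ.functor ⋙ baseFunctor Φ₂ B₂ DivB₂).obj X))),
      (∀ ⦃X Y : D₁⦄ (f : Y ⟶ X) (x : Φ₁.obj (op X)),
          φ Y ((Φ₁.map f.op).hom x) =
            (Φ₂.map ((zeroSection Φ₁ B₁ DivB₁ ⋙ Ψ.functor ⋙ baseFunctor Φ₂ B₂ DivB₂).map f).op).hom (φ X x)) ∧
      (∀ ⦃X Y : D₁⦄ (f : Y ⟶ X) (b : B₁.obj (op X)),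
          β Y ((B₁.map f.op).hom b) =
            (B₂.map ((zeroSection Φ₁ B₁ DivB₁ ⋙ Ψ.functor ⋙ baseFunctor Φ₂ B₂ DivB₂).map f).op).hom (β X b)) ∧
      ∀ (X : D₁) (b : B₁.obj (op X)),
        divB Φ₂ B₂ DivB₂ (op ((zeroSection Φ₁ B₁ DivB₁ ⋙ Ψ.functor ⋙ baseFunctor Φ₂ B₂ DivB₂).obj X)) (β X b) =
          MonGp.map (φ X).toMonoidHom (divB Φ₁ B₁ DivB₁ (op X) b) := by
  refine ⟨fun X => ΨΦ.iso (zeroObj Φ₁ B₁ DivB₁ X),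
    fun X => (ratIso hBg₁ hΦd₁ hF₁ (zeroObj Φ₁ B₁ DivB₁ X)).trans
      ((PreFrobenioid.BiratUnits.equivOfEquiv Ψ hΨ hb hF₁ hF₂ hΨ' hb' (zeroObj Φ₁ B₁ DivB₁ X)).trans
        (ratIso hBg₂ hΦd₂ hF₂ (Ψ.functor.obj (zeroObj Φ₁ B₁ DivB₁ X))).symm),
    fun X Y f x => ΨΦ.natural (zeroHom (Φ := Φ₁) (B := B₁) (DivB := DivB₁) 1 f) x,
    fun X Y f b => ratTransport_natural hBg₁ hΦd₁ hBg₂ hΦd₂ hF₁ hF₂ Ψ hΨ hb hΨ' hb' hpb f b,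
    fun X b => ratTransport_divB hBg₁ hΦd₁ hBg₂ hΦd₂ hF₁ hF₂ Ψ hΨ hb hΨ' hb' ΨΦ hdiv X b⟩

end ModelFrobenioid

end Literature.AlgebraicGeometry.Frobenioids

end
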